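import Summits.QuantumAdvantage.QuantumAdvantage.Theorems.CubicForrelationNearExactIsExactQuadPerturb
import Summits.QuantumAdvantage.QuantumAdvantage.Theorems.CubicForrelationNearExactIsExactAutocorr
import Summits.QuantumAdvantage.QuantumAdvantage.Theorems.CubicForrelationNearExactIsExactRothaus

/-!
# Crux `CubicForrelation.NearExactIsExact` (stmt-QuantumAdvantage-14043) — flat-supported perturbations

Line `direct-sum-amplification`, helper stubs `qp_forrelation_perturb_flat` and `qp_beta_sq_sum` (tag QP):
the `β`-formulation of a quadratic-type perturbation of an exact pair.

Let `n = m + m` and let `(d, g)` be an exact pair in dual form, `W_g(x) = 2^m (-1)^{d(x)}` for all `x`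
(`W` the unnormalised Walsh transform `DerivativeWalsh.W`). Suppose the perturbation `p` of `g` has Walsh
transform supported on the flat `a ⊕ U` with the flat values `W_p(w) = 2^{n-h} σ(w ⊕ a)` for `w ⊕ a ∈ U` and
`W_p(w) = 0` otherwise (for a quadratic `p` of symplectic rank `2h` this is Dickson's theorem; here it is a
hypothesis). Then, for an arbitrary perturbation `q` of `d`,

* `qp_forrelation_perturb_flat`:
  `Φ(d ⊕ q, g ⊕ p) = 2^{-n} 2^{-h} Σ_x (-1)^{d(x) ⊕ q(x)} Σ_{u ∈ U} σ(u) (-1)^{d(x ⊕ a ⊕ u)}`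
  — substitute the flat form of `W_p` into the landed `qp_forrelation_perturb`
  (`Φ(d ⊕ q, g ⊕ p) = 2^{-2n} Σ_w W_p(w) Σ_x (-1)^{d(x) ⊕ d(x ⊕ w) ⊕ q(x)}`), reindex `w = a ⊕ u`, swap the sums;
* `qp_beta_sq_sum`: if moreover `|U| = 4^h` and `σ(u)² = 1` on `U`, the function
  `β(x) = 2^{-h} Σ_{u ∈ U} σ(u) (-1)^{d(x ⊕ a ⊕ u)}` has second moment `Σ_x β(x)² = 2ⁿ` — expanding the square,
  the cross terms are autocorrelations of `(-1)^d` at the shifts `u ⊕ v`, and the dual `d` of the bent `g` is bent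
  (`bb_dual_isBent`), so by Wiener–Khinchin (`tb_sum_W_sq_mul_twist`) and character orthogonality its
  autocorrelation is `2ⁿ [u = v]` (`qp_dual_autocorr`, `qp_sum_translate_mul`); what is left is
  `4^{-h} · |U| · 2ⁿ = 2ⁿ`.

Sources: S. Aaronson, A. Ambainis, Forrelation, SIAM J. Comput. 47 (2018) §1.1.1 (definition of `Φ`);
R. O'Donnell, Analysis of Boolean Functions (2014), §1.4 (characters, Wiener–Khinchin); O. S. Rothaus,
On "bent" functions, J. Combin. Theory Ser. A 20 (1976) (the dual of a bent function is bent) — orientation only;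
everything below is proved from the tree (`qp_forrelation_perturb`, `tb_sum_W_sq_mul_twist`, `bb_dual_isBent`,
`sum_twist_left`, `bxorPerm`), axioms are the standard three. The Theses file is deliberately NOT imported.
-/

set_option linter.dupNamespace false -- D-0017: single-problem summit

noncomputable section

namespace Summit.QuantumAdvantage.QuantumAdvantage.Theorems.CubicForrelation.NearExactIsExact

open Finset
open Literature.Computability.QuantumComplexity
open Literature.Computability.QuantumComplexity.BuzetChailloux (bxor zeroVec signOf_sq bxor_comm
  bxor_bxor_cancel_left bxor_eq_zeroVec_iff bxorPerm bxorPerm_apply sum_twist_left)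
open Literature.Computability.QuantumComplexity.DerivativeWalsh (W)

variable {m : ℕ}

/-- **The autocorrelation of the dual of a bent function**: if `W_g = 2^m (-1)^d` on `n = m + m` bits, then
`Σ_y (-1)^{d(y)} (-1)^{d(y ⊕ s)} = 2ⁿ [s = 0]` (the dual `d` is bent, `W_d² = 2ⁿ`, so Wiener–Khinchin
`Σ_x W_d(x)² (-1)^{x·s} = 2ⁿ · AC_d(s)` reads `2ⁿ Σ_x (-1)^{x·s} = 2ⁿ · AC_d(s)`). -/
theorem qp_dual_autocorr {d g : (Fin (m + m) → Bool) → Bool}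
    (hdual : ∀ x, W (fun y => signOf (g y)) x = (2 : ℝ) ^ m * signOf (d x)) (s : Fin (m + m) → Bool) :
    ∑ y, signOf (d y) * signOf (d (bxor y s)) = if s = zeroVec then (2 : ℝ) ^ (m + m) else 0 := by
  have hN : (2 : ℝ) ^ (m + m) ≠ 0 := by positivity
  apply mul_left_cancel₀ hN
  rw [← tb_sum_W_sq_mul_twist (fun y => signOf (d y)) s]
  simp_rw [bb_dual_isBent hdual, ← mul_sum, sum_twist_left]

/-- **Orthogonality of the translates of the dual**: if `W_g = 2^m (-1)^d` on `n = m + m` bits, then for all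
`a u v`, `Σ_x (-1)^{d(x ⊕ a ⊕ u)} (-1)^{d(x ⊕ a ⊕ v)} = 2ⁿ [u = v]` (reindex `y = x ⊕ a ⊕ u`; the sum is the
autocorrelation of `(-1)^d` at the shift `u ⊕ v`). -/
theorem qp_sum_translate_mul {d g : (Fin (m + m) → Bool) → Bool}
    (hdual : ∀ x, W (fun y => signOf (g y)) x = (2 : ℝ) ^ m * signOf (d x))
    (a u v : Fin (m + m) → Bool) :
    ∑ x, signOf (d (bxor x (bxor a u))) * signOf (d (bxor x (bxor a v))) =
      if u = v then (2 : ℝ) ^ (m + m) else 0 := by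
  have key : ∑ x, signOf (d (bxor x (bxor a u))) * signOf (d (bxor x (bxor a v))) =
      ∑ y, signOf (d y) * signOf (d (bxor y (bxor u v))) := by
    refine Fintype.sum_equiv (bxorPerm (bxor a u)) _ _ fun x => ?_
    have e1 : bxor (bxor a u) x = bxor x (bxor a u) := bxor_comm _ _
    have e2 : bxor (bxor (bxor a u) x) (bxor u v) = bxor x (bxor a v) := by
      funext i
      show (((a i ^^ u i) ^^ x i) ^^ (u i ^^ v i)) = (x i ^^ (a i ^^ v i))
      cases a i <;> cases u i <;> cases v i <;> cases x i <;> rfl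
    rw [bxorPerm_apply, e2, e1]
  rw [key, qp_dual_autocorr hdual (bxor u v)]
  exact if_congr (bxor_eq_zeroVec_iff u v) rfl rfl

/-- **β-formulation of a flat-supported perturbation of an exact pair** (helper stub
`qp_forrelation_perturb_flat`, line `direct-sum-amplification`). If `W_g = 2^m (-1)^d` on `n = m + m` bits and
`W_p(w) = 2ⁿ 2^{-h} σ(w ⊕ a) [w ⊕ a ∈ U]`, then for every `q`,
`Φ(d ⊕ q, g ⊕ p) = 2^{-n} 2^{-h} Σ_x (-1)^{d(x) ⊕ q(x)} Σ_{u ∈ U} σ(u) (-1)^{d(x ⊕ (a ⊕ u))}`. -/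
theorem qp_forrelation_perturb_flat :
    ∀ (m h : ℕ) (d g p q : (Fin (m + m) → Bool) → Bool) (U : Finset (Fin (m + m) → Bool))
      (a : Fin (m + m) → Bool) (σ : (Fin (m + m) → Bool) → ℝ),
      (∀ x, W (fun y => signOf (g y)) x = (2 : ℝ) ^ m * signOf (d x)) →
      (∀ w, W (fun y => signOf (p y)) w =
        if bxor w a ∈ U then (2 : ℝ) ^ (m + m) * ((2 : ℝ) ^ h)⁻¹ * σ (bxor w a) else 0) →
      forrelation (fun x => d x ^^ q x) (fun y => g y ^^ p y) =
        ((2 : ℝ) ^ (m + m))⁻¹ * ((2 : ℝ) ^ h)⁻¹ *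
          ∑ x : Fin (m + m) → Bool, signOf (d x ^^ q x) *
            ∑ u ∈ U, σ u * signOf (d (bxor x (bxor a u))) := by
  intro m h d g p q U a σ hdual hflat
  rw [qp_forrelation_perturb m d g p q hdual]
  -- substitute the flat form of `W_p` and reindex `w = a ⊕ u`
  have h1 : ∑ w, W (fun y => signOf (p y)) w * ∑ x, signOf (d x ^^ d (bxor x w) ^^ q x) =
      ∑ u, if u ∈ U then (2 : ℝ) ^ (m + m) * ((2 : ℝ) ^ h)⁻¹ * σ u *
        ∑ x, signOf (d x ^^ d (bxor x (bxor a u)) ^^ q x) else 0 := by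
    refine Fintype.sum_equiv (bxorPerm a) _ _ fun w => ?_
    rw [bxorPerm_apply, bxor_bxor_cancel_left, hflat, bxor_comm w a, ite_mul, zero_mul]
  -- swap the two sums and split the signs
  have h2 : ∑ u ∈ U, (2 : ℝ) ^ (m + m) * ((2 : ℝ) ^ h)⁻¹ * σ u *
        ∑ x, signOf (d x ^^ d (bxor x (bxor a u)) ^^ q x) =
      (2 : ℝ) ^ (m + m) * ((2 : ℝ) ^ h)⁻¹ *
        ∑ x, signOf (d x ^^ q x) * ∑ u ∈ U, σ u * signOf (d (bxor x (bxor a u))) := by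
    rw [mul_sum]
    simp_rw [mul_sum]
    rw [sum_comm]
    refine sum_congr rfl fun x _ => sum_congr rfl fun u _ => ?_
    simp only [signOf_xor]
    ring
  rw [h1, Fintype.sum_extend_by_zero U, h2]
  -- constants: `2^{-2n} · 2ⁿ · 2^{-h} = 2^{-n} 2^{-h}`
  have hN : (2 : ℝ) ^ (m + m) ≠ 0 := by positivity
  rw [pow_mul']
  field_simp

/-- **Second moment of `β`** (helper stub `qp_beta_sq_sum`, line `direct-sum-amplification`). If
`W_g = 2^m (-1)^d` on `n = m + m` bits, `|U| = 4^h` and `σ² = 1` on `U`, then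
`Σ_x (2^{-h} Σ_{u ∈ U} σ(u) (-1)^{d(x ⊕ (a ⊕ u))})² = 2ⁿ`: the translates `x ↦ (-1)^{d(x ⊕ a ⊕ u)}`, `u ∈ U`,
are pairwise orthogonal of norm `2ⁿ` (`qp_sum_translate_mul`), so the sum is `4^{-h} · |U| · 2ⁿ`. -/
theorem qp_beta_sq_sum :
    ∀ (m h : ℕ) (d g : (Fin (m + m) → Bool) → Bool) (U : Finset (Fin (m + m) → Bool))
      (a : Fin (m + m) → Bool) (σ : (Fin (m + m) → Bool) → ℝ),
      (∀ x, W (fun y => signOf (g y)) x = (2 : ℝ) ^ m * signOf (d x)) →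
      U.card = 4 ^ h → (∀ u ∈ U, σ u ^ 2 = 1) →
      ∑ x : Fin (m + m) → Bool, (((2 : ℝ) ^ h)⁻¹ * ∑ u ∈ U, σ u * signOf (d (bxor x (bxor a u)))) ^ 2 =
        (2 : ℝ) ^ (m + m) := by
  intro m h d g U a σ hdual hU hσ
  -- expand the square
  have hA : ∀ x : Fin (m + m) → Bool,
      (((2 : ℝ) ^ h)⁻¹ * ∑ u ∈ U, σ u * signOf (d (bxor x (bxor a u)))) ^ 2 =
        (((2 : ℝ) ^ h)⁻¹) ^ 2 * ∑ u ∈ U, ∑ v ∈ U,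
          σ u * σ v * (signOf (d (bxor x (bxor a u))) * signOf (d (bxor x (bxor a v)))) := by
    intro x
    rw [mul_pow, sq (∑ u ∈ U, _), sum_mul_sum]
    congr 1
    exact sum_congr rfl fun u _ => sum_congr rfl fun v _ => by ring
  -- bring the sum over `x` inside
  have hB : ∑ x : Fin (m + m) → Bool, ∑ u ∈ U, ∑ v ∈ U,
        σ u * σ v * (signOf (d (bxor x (bxor a u))) * signOf (d (bxor x (bxor a v)))) =
      ∑ u ∈ U, ∑ v ∈ U, σ u * σ v *
        ∑ x : Fin (m + m) → Bool, signOf (d (bxor x (bxor a u))) * signOf (d (bxor x (bxor a v))) := by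
    rw [sum_comm]
    refine sum_congr rfl fun u _ => ?_
    rw [sum_comm]
    refine sum_congr rfl fun v _ => ?_
    rw [mul_sum]
  -- only the diagonal `u = v` survives
  have hC : ∀ u ∈ U, ∑ v ∈ U, σ u * σ v *
        ∑ x : Fin (m + m) → Bool, signOf (d (bxor x (bxor a u))) * signOf (d (bxor x (bxor a v))) =
      (2 : ℝ) ^ (m + m) := by
    intro u hu
    simp_rw [qp_sum_translate_mul hdual a u, mul_ite, mul_zero]
    rw [sum_ite_eq_of_mem U u _ hu, ← sq, hσ u hu, one_mul]
  rw [sum_congr rfl fun x _ => hA x, ← mul_sum, hB, sum_congr rfl hC, sum_const, hU, nsmul_eq_mul]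
  -- constants: `4^{-h} · 4^h · 2ⁿ = 2ⁿ`
  have h4 : ((4 ^ h : ℕ) : ℝ) = (2 : ℝ) ^ h * (2 : ℝ) ^ h := by
    push_cast
    rw [← mul_pow]
    norm_num
  have hc : (2 : ℝ) ^ h ≠ 0 := by positivity
  rw [h4]
  field_simp

end Summit.QuantumAdvantage.QuantumAdvantage.Theorems.CubicForrelation.NearExactIsExact

end
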